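import Summits.SmoothPoincare4.SmoothPoincare4.Theorems.SymplecticOrigamiGromovRecognitionRelEndStubCapModelCap2

/-!
# Wedge cap for `GromovRecognitionRelEnd` — gluing the corner chart: the maps `C₁ ⇀ OC`
(stub `stub_capModel` of line `cross-cap-laurent`, crux `SymplecticOrigami.GromovRecognitionRelEnd`,
item stmt-SmoothPoincare4-11009)

Second stage of the cap `C = C₁ ∪ OC`, `C₁ = OV ∪ OH`: the corner chart `(u, t) = (1/z₁, 1/z₂)`,
`OC = {|u| < R₁⁻¹} × {|t| < R₁⁻¹}`, is glued to `C₁` along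
`OC ∖ {(0,0)} = {t ≠ 0} ∪ {u ≠ 0}`: the part `{t ≠ 0}` to the `V`-chart by `(u, z₂) = (u, 1/t)`,
the part `{u ≠ 0}` to the `H`-chart by `(z₁, t) = (1/u, t)` (consistently on the overlap, where
both are points of the end). This file defines the two maps `gC : C₁ → OC`, `hC : OC → C₁` by
these formulas (`gC` through the inverses of the open embeddings `inl`, `inr` of `C₁`), proves
their consistency on the overlaps, smoothness, and packages them as the gluing partial
homeomorphism `glueC` and the gluing datum `dC1`.
-/

noncomputable section

-- the registered namespace `Summit.SmoothPoincare4.SmoothPoincare4.Theorems…` repeats a component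
set_option linter.dupNamespace false

open scoped Manifold ContDiff Topology
open Set Function Filter TopologicalSpace Literature.Geometry.Kaehler Literature.Geometry.Symplectic
  Literature.Topology.FourManifolds

namespace Summit.SmoothPoincare4.SmoothPoincare4.Theorems.GromovRecognitionRelEnd.CrossCapLaurent

namespace CapModel

/-- Model space `ℝ⁴ = ℂ²` (coordinates `0,1` = `z₁`, `2,3` = `z₂`). -/
local notation "E4" => EuclideanSpace ℝ (Fin 4)

variable {R₁ : ℝ} [hR : Fact (0 < R₁)]

/-- Notation-free abbreviation: the first stage `C₁ = OV ∪ OH`. [folklore] -/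
abbrev C₁ (R₁ : ℝ) [Fact (0 < R₁)] : Type := (dVH R₁).Glued

/-- The `V`-chart embedded in `C₁`. [folklore] -/
abbrev jV₁ : OV R₁ → C₁ R₁ := (dVH R₁).inl
/-- The `H`-chart embedded in `C₁`. [folklore] -/
abbrev jH₁ : OH R₁ → C₁ R₁ := (dVH R₁).inr

/-- The gluing identification of `C₁`: `jV₁ b = jH₁ b'` iff `b` is in the gluing region and
`b' = (1/u, 1/z₂)`. [folklore] -/
theorem jV₁_eq_jH₁_iff {b : OV R₁} {b' : OH R₁} :
    jV₁ b = jH₁ b' ↔ (r1 b.1 ≠ 0 ∧ R₁ ^ 2 < r2 b.1) ∧ mkH (inv12 b.1) = b' :=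
  (dVH R₁).inl_eq_inr_iff

/-! ## Elementary maps-to facts -/

/-- For `b ∈ OV` with `R₁² < |z₂|²`: `inv2 b ∈ OC` with `t ≠ 0`. [folklore] -/
theorem inv2_mapsV {p : E4} (hV : p ∈ OV R₁) (h2 : R₁ ^ 2 < r2 p) :
    inv2 p ∈ OC R₁ ∧ r2 (inv2 p) ≠ 0 :=
  ⟨mem_OC.2 ⟨by rw [r1_inv2]; exact hV, r2_inv2_lt hR.out h2⟩,
    by rw [r2_inv2]; exact inv_ne_zero (r2_ne_zero_of_sq_lt h2)⟩

/-- For `b ∈ OH` with `R₁² < |z₁|²`: `inv1 b ∈ OC` with `u ≠ 0`. [folklore] -/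
theorem inv1_mapsH {p : E4} (hH : p ∈ OH R₁) (h1 : R₁ ^ 2 < r1 p) :
    inv1 p ∈ OC R₁ ∧ r1 (inv1 p) ≠ 0 :=
  ⟨mem_OC.2 ⟨r1_inv1_lt hR.out h1, by rw [r2_inv1]; exact hH⟩,
    by rw [r1_inv1]; exact inv_ne_zero (r1_ne_zero_of_sq_lt h1)⟩

omit hR in
/-- For `c ∈ OC` with `t ≠ 0`: `inv2 c ∈ OV` with `R₁² < |z₂|²`. [folklore] -/
theorem inv2_mapsC {p : E4} (hC : p ∈ OC R₁) (h2 : r2 p ≠ 0) :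
    inv2 p ∈ OV R₁ ∧ R₁ ^ 2 < r2 (inv2 p) :=
  ⟨by rw [mem_OV, r1_inv2]; exact hC.1, sq_lt_r2_inv2 h2 hC.2⟩

omit hR in
/-- For `c ∈ OC` with `u ≠ 0`: `inv1 c ∈ OH` with `R₁² < |z₁|²`. [folklore] -/
theorem inv1_mapsC {p : E4} (hC : p ∈ OC R₁) (h1 : r1 p ≠ 0) :
    inv1 p ∈ OH R₁ ∧ R₁ ^ 2 < r1 (inv1 p) :=
  ⟨by rw [mem_OH, r2_inv1]; exact hC.2, sq_lt_r1_inv1 h1 hC.1⟩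

/-! ## The gluing map `gC : C₁ → OC` -/

/-- **The gluing map** `C₁ → OC`: `(u, z₂) ↦ (u, 1/z₂)` on the `V`-chart, `(z₁, t) ↦ (1/z₁, t)`
on the `H`-chart (junk off the gluing region). [folklore] -/
def gC (y : C₁ R₁) : OC R₁ :=
  open scoped Classical in
  if y ∈ range (jV₁ : OV R₁ → C₁ R₁) then mkC (inv2 (invFun (jV₁ : OV R₁ → C₁ R₁) y).1)
  else mkC (inv1 (invFun (jH₁ : OH R₁ → C₁ R₁) y).1)

/-- `gC` on the `V`-chart. [folklore] -/
theorem gC_jV₁ (b : OV R₁) : gC (jV₁ b) = mkC (inv2 b.1) := by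
  simp only [gC, mem_range_self, if_true, invFun_apply (dVH R₁).inl_injective]

/-- Consistency: for `b` in the gluing region of `C₁`, `inv1 (inv12 b) = inv2 b`. [folklore] -/
theorem inv1_inv12 {p : E4} (h1 : r1 p ≠ 0) : inv1 (inv12 p) = inv2 p := by
  rw [inv12, inv1_inv2, inv1_inv1 h1]

/-- Consistency: `inv2 (inv12 b) = inv1 b` off the axis `z₂ = 0`. [folklore] -/
theorem inv2_inv12 {p : E4} (h2 : r2 p ≠ 0) : inv2 (inv12 p) = inv1 p := by
  rw [inv12, inv2_inv2 (by rwa [r2_inv1])]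

/-- `gC` on the `H`-chart (consistent with the `V`-formula on the overlap). [folklore] -/
theorem gC_jH₁ (b : OH R₁) : gC (jH₁ b) = mkC (inv1 b.1) := by
  by_cases h : (jH₁ b : C₁ R₁) ∈ range (jV₁ : OV R₁ → C₁ R₁)
  · obtain ⟨b', hb'⟩ := h
    obtain ⟨⟨h1, h2⟩, hbb⟩ := jV₁_eq_jH₁_iff.1 hb'
    rw [← hb', gC_jV₁, ← hbb]
    show mkC (inv2 b'.1) = mkC (inv1 (mkH (inv12 b'.1)).1)
    rw [mkH, val_toOpens (inv12_mapsV b'.2 h1 h2).1, inv1_inv12 h1]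
  · simp only [gC, h, if_false, invFun_apply (dVH R₁).inr_injective]

/-- Near a point of the `V`-chart, `gC = (mkC ∘ inv2 ∘ val) ∘ jV₁⁻¹`. [folklore] -/
theorem gC_eventuallyEq_V (b : OV R₁) : gC =ᶠ[𝓝 (jV₁ b)]
    (toOpens (OC R₁) oC ∘ inv2 ∘ Subtype.val) ∘ invFun (jV₁ : OV R₁ → C₁ R₁) := by
  filter_upwards [(dVH R₁).isOpen_range_inl.mem_nhds (mem_range_self b)] with y hy
  obtain ⟨b', rfl⟩ := hy
  simp only [Function.comp_apply, gC_jV₁, invFun_apply (dVH R₁).inl_injective]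
  rfl

/-- Near a point of the `H`-chart, `gC = (mkC ∘ inv1 ∘ val) ∘ jH₁⁻¹`. [folklore] -/
theorem gC_eventuallyEq_H (b : OH R₁) : gC =ᶠ[𝓝 (jH₁ b)]
    (toOpens (OC R₁) oC ∘ inv1 ∘ Subtype.val) ∘ invFun (jH₁ : OH R₁ → C₁ R₁) := by
  filter_upwards [(dVH R₁).isOpen_range_inr.mem_nhds (mem_range_self b)] with y hy
  obtain ⟨b', rfl⟩ := hy
  simp only [Function.comp_apply, gC_jH₁, invFun_apply (dVH R₁).inr_injective]
  rfl

/-- `gC` is `C^∞` at `jV₁ b` when `z₂ ≠ 0` at `b`. [folklore] -/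
theorem contMDiffAt_gC_V {b : OV R₁} (h2 : R₁ ^ 2 < r2 b.1) :
    ContMDiffAt 𝓘(ℝ, E4) 𝓘(ℝ, E4) ∞ (gC : C₁ R₁ → OC R₁) (jV₁ b) := by
  refine ContMDiffAt.congr_of_eventuallyEq ?_ (gC_eventuallyEq_V b)
  refine ContMDiffAt.comp (jV₁ b) ?_ (contMDiffAt_invFun (dVH R₁).isSmoothEmbedding_inl
    (dVH R₁).isOpen_range_inl (mem_range_self b))
  rw [invFun_apply (dVH R₁).inl_injective]
  exact contMDiffAt_pieceMap (contDiffAt_inv2 (r2_ne_zero_of_sq_lt h2)) (inv2_mapsV b.2 h2).1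

/-- `gC` is `C^∞` at `jH₁ b` when `z₁ ≠ 0` at `b`. [folklore] -/
theorem contMDiffAt_gC_H {b : OH R₁} (h1 : R₁ ^ 2 < r1 b.1) :
    ContMDiffAt 𝓘(ℝ, E4) 𝓘(ℝ, E4) ∞ (gC : C₁ R₁ → OC R₁) (jH₁ b) := by
  refine ContMDiffAt.congr_of_eventuallyEq ?_ (gC_eventuallyEq_H b)
  refine ContMDiffAt.comp (jH₁ b) ?_ (contMDiffAt_invFun (dVH R₁).isSmoothEmbedding_inr
    (dVH R₁).isOpen_range_inr (mem_range_self b))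
  rw [invFun_apply (dVH R₁).inr_injective]
  exact contMDiffAt_pieceMap (contDiffAt_inv1 (r1_ne_zero_of_sq_lt h1)) (inv1_mapsH b.2 h1).1

/-! ## The inverse gluing map `hC : OC → C₁` -/

/-- **The inverse gluing map** `OC → C₁`: `(u, t) ↦ (u, 1/t)` in the `V`-chart if `t ≠ 0`, else
`(1/u, t)` in the `H`-chart. [folklore] -/
def hC (c : OC R₁) : C₁ R₁ :=
  open scoped Classical in
  if r2 c.1 ≠ 0 then jV₁ (mkV (inv2 c.1)) else jH₁ (mkH (inv1 c.1))

/-- `hC` where `t ≠ 0`. [folklore] -/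
theorem hC_of_r2 {c : OC R₁} (h2 : r2 c.1 ≠ 0) : hC c = jV₁ (mkV (inv2 c.1)) := by
  simp only [hC, h2, ne_eq, not_false_eq_true, if_true]

/-- **Consistency of the two inverse formulas** on `{u ≠ 0, t ≠ 0}`. [folklore] -/
theorem jV₁_mkV_inv2_eq {c : OC R₁} (h1 : r1 c.1 ≠ 0) (h2 : r2 c.1 ≠ 0) :
    jV₁ (mkV (inv2 c.1)) = (jH₁ (mkH (inv1 c.1)) : C₁ R₁) := by
  obtain ⟨hm, hlt⟩ := inv2_mapsC c.2 h2
  rw [jV₁_eq_jH₁_iff, mkV, val_toOpens hm]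
  refine ⟨⟨by rwa [r1_inv2], hlt⟩, ?_⟩
  rw [inv12, inv1_inv2, inv2_inv2 (by rwa [r2_inv1])]

/-- `hC` where `u ≠ 0`. [folklore] -/
theorem hC_of_r1 {c : OC R₁} (h1 : r1 c.1 ≠ 0) : hC c = jH₁ (mkH (inv1 c.1)) := by
  by_cases h2 : r2 c.1 ≠ 0
  · rw [hC_of_r2 h2, jV₁_mkV_inv2_eq h1 h2]
  · simp only [hC, h2, if_false]

/-- `hC` is `C^∞` at the points with `t ≠ 0`. [folklore] -/
theorem contMDiffAt_hC_of_r2 {c : OC R₁} (h2 : r2 c.1 ≠ 0) :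
    ContMDiffAt 𝓘(ℝ, E4) 𝓘(ℝ, E4) ∞ (hC : OC R₁ → C₁ R₁) c := by
  have hev : (hC : OC R₁ → C₁ R₁) =ᶠ[𝓝 c] jV₁ ∘ (toOpens (OV R₁) oV ∘ inv2 ∘ Subtype.val) := by
    filter_upwards [(isOpen_r2_ne.preimage continuous_subtype_val).mem_nhds h2] with c' hc'
    exact hC_of_r2 hc'
  refine ContMDiffAt.congr_of_eventuallyEq ?_ hev
  exact ((dVH R₁).contMDiff_inl _).comp c
    (contMDiffAt_pieceMap (contDiffAt_inv2 h2) (inv2_mapsC c.2 h2).1)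

/-- `hC` is `C^∞` at the points with `u ≠ 0`. [folklore] -/
theorem contMDiffAt_hC_of_r1 {c : OC R₁} (h1 : r1 c.1 ≠ 0) :
    ContMDiffAt 𝓘(ℝ, E4) 𝓘(ℝ, E4) ∞ (hC : OC R₁ → C₁ R₁) c := by
  have hev : (hC : OC R₁ → C₁ R₁) =ᶠ[𝓝 c] jH₁ ∘ (toOpens (OH R₁) oH ∘ inv1 ∘ Subtype.val) := by
    filter_upwards [(isOpen_r1_ne.preimage continuous_subtype_val).mem_nhds h1] with c' hc'
    exact hC_of_r1 hc'
  refine ContMDiffAt.congr_of_eventuallyEq ?_ hev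
  exact ((dVH R₁).contMDiff_inr _).comp c
    (contMDiffAt_pieceMap (contDiffAt_inv1 h1) (inv1_mapsC c.2 h1).1)

/-! ## The gluing partial homeomorphism -/

/-- **The gluing partial homeomorphism `C₁ ⇀ OC`** of the corner chart. [folklore] -/
def glueC : OpenPartialHomeomorph (C₁ R₁) (OC R₁) where
  toFun := gC
  invFun := hC
  source := jV₁ '' {b : OV R₁ | R₁ ^ 2 < r2 b.1} ∪ jH₁ '' {b : OH R₁ | R₁ ^ 2 < r1 b.1}
  target := {c | r1 c.1 ≠ 0 ∨ r2 c.1 ≠ 0}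
  map_source' := by
    rintro y (⟨b, hb, rfl⟩ | ⟨b, hb, rfl⟩)
    · right
      rw [gC_jV₁, mkC, val_toOpens (inv2_mapsV b.2 hb).1]
      exact (inv2_mapsV b.2 hb).2
    · left
      rw [gC_jH₁, mkC, val_toOpens (inv1_mapsH b.2 hb).1]
      exact (inv1_mapsH b.2 hb).2
  map_target' c hc := by
    by_cases h2 : r2 c.1 ≠ 0
    · left
      refine ⟨mkV (inv2 c.1), ?_, (hC_of_r2 h2).symm⟩
      show R₁ ^ 2 < r2 (mkV (inv2 c.1)).1
      rw [mkV, val_toOpens (inv2_mapsC c.2 h2).1]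
      exact (inv2_mapsC c.2 h2).2
    · have h1 : r1 c.1 ≠ 0 := hc.resolve_right h2
      right
      refine ⟨mkH (inv1 c.1), ?_, (hC_of_r1 h1).symm⟩
      show R₁ ^ 2 < r1 (mkH (inv1 c.1)).1
      rw [mkH, val_toOpens (inv1_mapsC c.2 h1).1]
      exact (inv1_mapsC c.2 h1).2
  left_inv' := by
    rintro y (⟨b, hb, rfl⟩ | ⟨b, hb, rfl⟩)
    · have h2 : r2 b.1 ≠ 0 := r2_ne_zero_of_sq_lt hb
      rw [gC_jV₁, hC_of_r2 (by rw [mkC, val_toOpens (inv2_mapsV b.2 hb).1]; exact (inv2_mapsV b.2 hb).2)]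
      congr 1
      apply Subtype.ext
      rw [mkC, val_toOpens (inv2_mapsV b.2 hb).1, mkV, val_toOpens (by rw [inv2_inv2 h2]; exact b.2),
        inv2_inv2 h2]
    · have h1 : r1 b.1 ≠ 0 := r1_ne_zero_of_sq_lt hb
      rw [gC_jH₁, hC_of_r1 (by rw [mkC, val_toOpens (inv1_mapsH b.2 hb).1]; exact (inv1_mapsH b.2 hb).2)]
      congr 1
      apply Subtype.ext
      rw [mkC, val_toOpens (inv1_mapsH b.2 hb).1, mkH, val_toOpens (by rw [inv1_inv1 h1]; exact b.2),
        inv1_inv1 h1]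
  right_inv' c hc := by
    by_cases h2 : r2 c.1 ≠ 0
    · rw [hC_of_r2 h2, gC_jV₁]
      apply Subtype.ext
      rw [mkV, val_toOpens (inv2_mapsC c.2 h2).1, mkC, val_toOpens (by rw [inv2_inv2 h2]; exact c.2),
        inv2_inv2 h2]
    · have h1 : r1 c.1 ≠ 0 := hc.resolve_right h2
      rw [hC_of_r1 h1, gC_jH₁]
      apply Subtype.ext
      rw [mkH, val_toOpens (inv1_mapsC c.2 h1).1, mkC, val_toOpens (by rw [inv1_inv1 h1]; exact c.2),
        inv1_inv1 h1]
  open_source := ((dVH R₁).isOpenMap_inl _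
      ((isOpen_lt continuous_const continuous_r2).preimage continuous_subtype_val)).union
    ((dVH R₁).isOpenMap_inr _
      ((isOpen_lt continuous_const continuous_r1).preimage continuous_subtype_val))
  open_target := (isOpen_r1_ne.preimage continuous_subtype_val).union
    (isOpen_r2_ne.preimage continuous_subtype_val)
  continuousOn_toFun := by
    rintro y (⟨b, hb, rfl⟩ | ⟨b, hb, rfl⟩)
    · exact (contMDiffAt_gC_V hb).continuousAt.continuousWithinAt
    · exact (contMDiffAt_gC_H hb).continuousAt.continuousWithinAt
  continuousOn_invFun c hc := by
    rcases hc with h1 | h2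
    · exact (contMDiffAt_hC_of_r1 h1).continuousAt.continuousWithinAt
    · exact (contMDiffAt_hC_of_r2 h2).continuousAt.continuousWithinAt

/-- `glueC` as a function. [folklore] -/
theorem glueC_apply (y : C₁ R₁) : (glueC : OpenPartialHomeomorph (C₁ R₁) (OC R₁)) y = gC y := rfl
/-- `glueC.symm` as a function. [folklore] -/
theorem glueC_symm_apply (c : OC R₁) : (glueC : OpenPartialHomeomorph (C₁ R₁) (OC R₁)).symm c = hC c := rfl
/-- The source of `glueC`. [folklore] -/
theorem glueC_source : (glueC : OpenPartialHomeomorph (C₁ R₁) (OC R₁)).source =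
    jV₁ '' {b : OV R₁ | R₁ ^ 2 < r2 b.1} ∪ jH₁ '' {b : OH R₁ | R₁ ^ 2 < r1 b.1} := rfl
/-- The target of `glueC`. [folklore] -/
theorem glueC_target : (glueC : OpenPartialHomeomorph (C₁ R₁) (OC R₁)).target =
    {c | r1 c.1 ≠ 0 ∨ r2 c.1 ≠ 0} := rfl

variable (R₁) in
/-- **The gluing datum of the corner chart**: `C = C₁ ∪_{glueC} OC`. [folklore] -/
def dC1 : SmoothGlueData 𝓘(ℝ, E4) 𝓘(ℝ, E4) (C₁ R₁) (OC R₁) E4 where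
  glue := glueC
  contMDiffOn_glue := by
    rintro y (⟨b, hb, rfl⟩ | ⟨b, hb, rfl⟩)
    · exact (contMDiffAt_gC_V hb).contMDiffWithinAt
    · exact (contMDiffAt_gC_H hb).contMDiffWithinAt
  contMDiffOn_glue_symm c hc := by
    rcases hc with h1 | h2
    · exact (contMDiffAt_hC_of_r1 h1).contMDiffWithinAt
    · exact (contMDiffAt_hC_of_r2 h2).contMDiffWithinAt
  linA := ContinuousLinearEquiv.refl ℝ E4
  linB := ContinuousLinearEquiv.refl ℝ E4

/-- The glue of `dC1` is `glueC`. [folklore] -/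
theorem dC1_glue : (dC1 R₁).glue = glueC := rfl

end CapModel

/-- **Registered helper sub-goal `helper_capModelCornerConsistency`** (file `Cap3` of stub
`stub_capModel`): consistency of the corner chart with the two sphere charts —
`(1/·, ·) ∘ (1/·, 1/·) = (·, 1/·)` off the axis `z₁ = 0`. [folklore] -/
theorem helper_capModelCornerConsistency : ∀ p : EuclideanSpace ℝ (Fin 4), p 0 ^ 2 + p 1 ^ 2 ≠ 0 →
    (fun q : EuclideanSpace ℝ (Fin 4) => (WithLp.toLp 2 ![q 0 / (q 0 ^ 2 + q 1 ^ 2),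
      -(q 1) / (q 0 ^ 2 + q 1 ^ 2), q 2, q 3] : EuclideanSpace ℝ (Fin 4)))
      ((fun q : EuclideanSpace ℝ (Fin 4) => (WithLp.toLp 2 ![q 0, q 1, q 2 / (q 2 ^ 2 + q 3 ^ 2),
        -(q 3) / (q 2 ^ 2 + q 3 ^ 2)] : EuclideanSpace ℝ (Fin 4)))
        ((fun q : EuclideanSpace ℝ (Fin 4) => (WithLp.toLp 2 ![q 0 / (q 0 ^ 2 + q 1 ^ 2),
          -(q 1) / (q 0 ^ 2 + q 1 ^ 2), q 2, q 3] : EuclideanSpace ℝ (Fin 4))) p)) =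
    (WithLp.toLp 2 ![p 0, p 1, p 2 / (p 2 ^ 2 + p 3 ^ 2), -(p 3) / (p 2 ^ 2 + p 3 ^ 2)]) :=
  fun _ h => CapModel.inv1_inv12 h

end Summit.SmoothPoincare4.SmoothPoincare4.Theorems.GromovRecognitionRelEnd.CrossCapLaurent
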